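import Summits.NavierStokesRegularity.FluidComputer.GateBudgetToothClock
import Summits.NavierStokesRegularity.FluidComputer.GateBudgetMemberState
import HarnessLib

/-!
# What no tuning can beat, part 29: THE COMB AT AN INSTANT — at M = K¹⁰ every tooth is below
# 3/4 until √2 + 0.96/K and above 3/4 from √2 + 1/K on, every dud below 1/10 until √2 + 1/8

Cell `pub-fluidc`, blueprint seat bp1 (gen 31, seventh item); same namespace and conventions
as parts 1–28 (`GateBudget*.lean`); imports part 27 (`GateBudgetToothClock`: the rise and the
wait of a tooth behind its levels) and part 28 (`GateBudgetMemberState`: the levels of every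
member of the window at `M = K¹⁰`, with Tao's critical window `2 - 24 log K/K¹⁰ ≤ s₀² ≤
2 + 2/K¹⁰`). Modes `0 = a`, `1 = b` clock, `2 = c` catalyst, `3 = d` transfer, `4 = ã` output.
HONEST FRAMING (verbatim): low prior, high value-of-information experiment on Tao's machine
paradigm; NOT a claim that NS blows up.

THE POINT. Parts 20–28 speak of each member at ITS OWN times `s₀ < T ≤ s₀ + 242/K⁹`. But the
critical window of part 28 does not see the knob: `√(2 - 24 log K/K¹⁰) ≤ s₀ ≤ √(2 + 2/K¹⁰)`
for EVERY member. §83 (`knob_tooth_clock`) composes part 28's state of a half-lattice member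
(`2ε = (2k + 1)K¹⁰ρ²`: the pin `|d(T)| ≥ 19931/20000`, `b(T) ≤ -ε/4`, `c(T) ≤ λ₀ρ²`,
`ã(T) ≤ 10⁻³`) with part 27's rise and wait — from (5.6) at `t = 0`, no level hypothesis
left. §84 (`knob_comb_switches`) trades the member's times for INSTANTS: every tooth of the
window `200ε/K²⁰ ≤ ρ² ≤ 2ε/K¹⁰` has `ã(t) ≤ 3/4` for all `t ≤ √(2 - 24 log K/K¹⁰) + 24/(25K)`
and `ã(t) ≥ 3/4` for all `t ≥ √(2 + 2/K¹⁰) + 242/K⁹ + 1/K` (likewise `19/20` with `9/(5K)`,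
`2/K`, and the floor `0.996·tanh(0.996K/8)` from `√(2 + 2/K¹⁰) + 242/K⁹ + 1/8` on); §85
(`knob_dud_holds`) puts the lattice members (`ε = kK¹⁰ρ²`) on the same clock: `ã(t)² ≤ 1/100`
for all `t ∈ [0, √(2 - 24 log K/K¹⁰) + 1/8]`. THE WHOLE COMB SWITCHES INSIDE
`[√2 + 0.96/K - O(log K/K¹⁰), √2 + 1/K + O(K⁻⁹)]` — at `K = 16`, inside `[1.474, 1.477]` —
WHILE EVERY DUD IS STILL BELOW `1/10` (until `√2 + 1/8 - O(log K/K¹⁰) ≥ 1.53`): a simultaneous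
comb, without any comparison of trajectories at different knob values.

HONEST LIMITS. (i) The instant is common because the critical time is (`tc_window`), not
because the dousing time is monotone in `ρ` — SPEC (6′) as a statement about `T(ρ)` stays
open; the jitter certified across the comb is `0.04/K + O(log K/K¹⁰)` at the `3/4` crossing.
(ii) Duds are capped on `[0, √(2 - 24 log K/K¹⁰) + 1/8]` only (part 17's freeze window); no
second-pulse exclusion after it. (iii) Teeth: nothing between `0.996·tanh(0.996K/8)` and `1`
after the window. (iv) Numbers at `M = K¹⁰`, `K ≥ 16`, on the window `w ≤ K¹⁰/200` only.
(v) Nothing about Navier–Stokes: statements about the five-mode circuit (5.6).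
[cite: Tao2016AveragedNS, §5.5 Theorem 5.3, (5.5), (5.6), (b-eq), (c-eq), (tcable)]
-/

noncomputable section

namespace Summit.NavierStokesRegularity.FluidComputer.GateBudget

open Real Set Filter Topology
open Literature.Analysis.FluidPDE.Tao2016AveragedNS

/-! ## §83 The clock of a tooth, from the dynamics -/

/-- **THE CLOCK OF A TOOTH, FROM (5.6).** For `K ≥ 16`, `0 < ε`, `ε² ≤ 1/(6K²⁰)`, an exact
trajectory of `rotorCircuit K K¹⁰ ε ρ` from (5.6) on the HALF lattice `2ε = (2k + 1)K¹⁰ρ²` of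
the window `200ε/K²⁰ ≤ ρ² ≤ 2ε/K¹⁰`: there are its own times with `2 - 24 log K/K¹⁰ ≤ s₀² ≤
2 + 2/K¹⁰`, `1 ≤ s₀ ≤ 3/2`, `s₀ < T ≤ s₀ + 242/K⁹`, `|d(T)| ≥ 19931/20000`, and with
`r = 249/250`: `ã(t) ≥ r·tanh(rK(t - T))` on `[T, T + 1/8]`, `ã ≥ r·tanh(rK/8)` after it,
`ã ≥ 3/4` from `T + 1/K` on, `ã ≥ 19/20` from `T + 2/K` on, and `ã(t) ≤ 3/4` for EVERY
`t ≤ T + 24/(25K)`, `ã(t) ≤ 19/20` for every `t ≤ T + 9/(5K)` (part 28's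
`knob_member_state_headline` at `|sin(k + ½)π| = 1`, `cos = 0`; part 27's
`knob_tooth_rises_of_pin` and `knob_tooth_waits_of_clock`; `ã` monotone before `T`).
[cite: Tao2016AveragedNS, §5.5 Theorem 5.3, (5.5), (5.6), (b-eq), (c-eq), (tcable)] -/
theorem knob_tooth_clock {K ε ρ : ℝ} {X : ℝ → Fin 5 → ℝ} {C : ℝ → ℝ}
    (hX : ∀ t, HasDerivAt X (RotorKnob.rotorCircuit K (K ^ 10) ε ρ (X t)) t)
    (h0 : X 0 = delayInit) (hC : ∀ t, HasDerivAt C (X t 2) t) (hK : 16 ≤ K) (hε : 0 < ε)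
    (hεK : ε ^ 2 ≤ 1 / (6 * K ^ 20)) (hρ : 0 < ρ) (hlo : 200 * ε / K ^ 20 ≤ ρ ^ 2)
    (hhi : K ^ 10 * ρ ^ 2 ≤ 2 * ε) (k : ℕ) (hk : 2 * ε = (2 * k + 1) * K ^ 10 * ρ ^ 2) :
    ∃ s₀ T : ℝ, 2 - 24 * Real.log K / K ^ 10 ≤ s₀ ^ 2 ∧ s₀ ^ 2 ≤ 2 + 2 / K ^ 10 ∧
      1 ≤ s₀ ∧ s₀ ≤ 3 / 2 ∧ s₀ < T ∧ T - s₀ ≤ 242 / K ^ 9 ∧ 19931 / 20000 ≤ |X T 3| ∧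
      (∀ t ∈ Icc T (T + 1 / 8), 249 / 250 * tanh (K * (249 / 250) * (t - T)) ≤ X t 4) ∧
      (∀ t, T + 1 / 8 ≤ t → 249 / 250 * tanh (K * (249 / 250) * (1 / 8)) ≤ X t 4) ∧
      (∀ t, T + 1 / K ≤ t → 3 / 4 ≤ X t 4) ∧ (∀ t, T + 2 / K ≤ t → 19 / 20 ≤ X t 4) ∧
      (∀ t, t ≤ T + 24 / (25 * K) → X t 4 ≤ 3 / 4) ∧
      (∀ t, t ≤ T + 9 / (5 * K) → X t 4 ≤ 19 / 20) := by
  have hK0 : 0 < K := by linarith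
  obtain ⟨s₀, T, hsq1, hsq2, hs1, hs2, hsT, hTs, hbT, hcT, heT, -, -, -, hd2⟩ :=
    knob_member_state_headline hX h0 hC hK hε hεK hρ hlo hhi
  -- half-way between lattice points `wπ = kπ + π/2`: `|sin| = 1`, `cos = 0`
  have hw : ε / (K ^ 10 * ρ ^ 2) * π = k * π + π / 2 := by
    have : ε / (K ^ 10 * ρ ^ 2) = k + 1 / 2 := by
      rw [div_eq_iff (by positivity)]; linarith
    rw [this]; ring
  have hs : |sin (ε / (K ^ 10 * ρ ^ 2) * π)| = 1 := by
    rw [hw, Real.sin_add_pi_div_two]; exact_mod_cast Real.abs_cos_int_mul_pi k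
  have hc : |cos (ε / (K ^ 10 * ρ ^ 2) * π)| = 0 := by
    rw [hw, Real.cos_add_pi_div_two, abs_neg, Real.sin_nat_mul_pi, abs_zero]
  rw [hs, hc] at hd2
  have hpin : 19931 / 20000 ≤ |X T 3| := by linarith
  have hT0 : 0 ≤ T := by linarith
  -- part 27: the rise behind the pin, the wait behind the small output
  obtain ⟨hr1, hr2, hr3, hr4⟩ := knob_tooth_rises_of_pin hX h0 hK hε hρ hT0 hbT hcT hpin
  obtain ⟨hw1, hw2⟩ := knob_tooth_waits_of_clock hX h0 hK hε hT0 hbT heT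
  -- before `T` the output is below `ã(T)` (it never decreases)
  have hmon : Monotone fun t => X t 4 := RotorKnob.rotorCircuit_output_monotone hK0.le hX
  have h24 : (0 : ℝ) < 24 / (25 * K) := by positivity
  have h9 : (0 : ℝ) < 9 / (5 * K) := by positivity
  refine ⟨s₀, T, hsq1, hsq2, hs1, hs2, hsT, hTs, hpin, hr1, hr2, hr3, hr4, fun t ht => ?_,
    fun t ht => ?_⟩
  · rcases le_total T t with hTt | htT
    · exact hw1 t ⟨hTt, ht⟩
    · exact (hmon htT).trans (hw1 T ⟨le_rfl, by linarith⟩)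
  · rcases le_total T t with hTt | htT
    · exact hw2 t ⟨hTt, ht⟩
    · exact (hmon htT).trans (hw2 T ⟨le_rfl, by linarith⟩)

/-! ## §84 The comb at an instant: the teeth -/

/-- **THE COMB SWITCHES AT AN INSTANT.** Under the hypotheses of `knob_tooth_clock` (ANY
half-lattice member of the window at `M = K¹⁰`, `K ≥ 16`): `ã(t) ≤ 3/4` for EVERY
`t ≤ √(2 - 24 log K/K¹⁰) + 24/(25K)` and `ã(t) ≥ 3/4` for every
`t ≥ √(2 + 2/K¹⁰) + 242/K⁹ + 1/K`; `ã(t) ≤ 19/20` for every `t ≤ √(2 - 24 log K/K¹⁰) + 9/(5K)`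
and `ã(t) ≥ 19/20` for every `t ≥ √(2 + 2/K¹⁰) + 242/K⁹ + 2/K`; and
`ã(t) ≥ 0.996·tanh(0.996K/8)` for every `t ≥ √(2 + 2/K¹⁰) + 242/K⁹ + 1/8`. The instants do not
depend on the member: EVERY TOOTH OF THE COMB SWITCHES THROUGH `3/4` INSIDE
`[√(2 - 24 log K/K¹⁰) + 0.96/K, √(2 + 2/K¹⁰) + 242/K⁹ + 1/K]` (§83 and
`√(2 - 24 log K/K¹⁰) ≤ s₀ ≤ √(2 + 2/K¹⁰)`).
[cite: Tao2016AveragedNS, §5.5 Theorem 5.3, (5.5), (5.6), (b-eq), (c-eq), (tcable)] -/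
theorem knob_comb_switches {K ε ρ : ℝ} {X : ℝ → Fin 5 → ℝ} {C : ℝ → ℝ}
    (hX : ∀ t, HasDerivAt X (RotorKnob.rotorCircuit K (K ^ 10) ε ρ (X t)) t)
    (h0 : X 0 = delayInit) (hC : ∀ t, HasDerivAt C (X t 2) t) (hK : 16 ≤ K) (hε : 0 < ε)
    (hεK : ε ^ 2 ≤ 1 / (6 * K ^ 20)) (hρ : 0 < ρ) (hlo : 200 * ε / K ^ 20 ≤ ρ ^ 2)
    (hhi : K ^ 10 * ρ ^ 2 ≤ 2 * ε) (k : ℕ) (hk : 2 * ε = (2 * k + 1) * K ^ 10 * ρ ^ 2) :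
    (∀ t, t ≤ √(2 - 24 * Real.log K / K ^ 10) + 24 / (25 * K) → X t 4 ≤ 3 / 4) ∧
    (∀ t, √(2 + 2 / K ^ 10) + 242 / K ^ 9 + 1 / K ≤ t → 3 / 4 ≤ X t 4) ∧
    (∀ t, t ≤ √(2 - 24 * Real.log K / K ^ 10) + 9 / (5 * K) → X t 4 ≤ 19 / 20) ∧
    (∀ t, √(2 + 2 / K ^ 10) + 242 / K ^ 9 + 2 / K ≤ t → 19 / 20 ≤ X t 4) ∧
    (∀ t, √(2 + 2 / K ^ 10) + 242 / K ^ 9 + 1 / 8 ≤ t →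
      249 / 250 * tanh (K * (249 / 250) * (1 / 8)) ≤ X t 4) := by
  obtain ⟨s₀, T, hsq1, hsq2, hs1, -, hsT, hTs, -, -, hr2, hr3, hr4, hw1, hw2⟩ :=
    knob_tooth_clock hX h0 hC hK hε hεK hρ hlo hhi k hk
  have hs0 : 0 ≤ s₀ := by linarith
  -- the member's critical time inside the common window
  have hlow : √(2 - 24 * Real.log K / K ^ 10) ≤ s₀ := (Real.sqrt_le_left hs0).2 hsq1
  have hup : s₀ ≤ √(2 + 2 / K ^ 10) := Real.le_sqrt_of_sq_le hsq2
  refine ⟨fun t ht => hw1 t (by linarith), fun t ht => hr3 t (by linarith),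
    fun t ht => hw2 t (by linarith), fun t ht => hr4 t (by linarith),
    fun t ht => hr2 t (by linarith)⟩

/-! ## §85 The comb at an instant: the duds -/

/-- **THE DUDS HOLD AT THE SAME INSTANTS.** For `K ≥ 16`, `0 < ε`, `ε² ≤ 1/(6K²⁰)`, an exact
trajectory of `rotorCircuit K K¹⁰ ε ρ` from (5.6) ON the lattice `ε = kK¹⁰ρ²` of the window
`200ε/K²⁰ ≤ ρ² ≤ 2ε/K¹⁰`: `ã(t)² ≤ 1/100` for EVERY `t ∈ [0, √(2 - 24 log K/K¹⁰) + 1/8]` — in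
particular at every instant of §84 at which the teeth have switched (`1/K ≤ 1/16 < 1/8`, up to
the window's width). Part 28's state at `sin kπ = 0`, `|cos kπ| = 1` (pin
`|a(T)| ≥ 19931/20000`), part 25a's `knob_member_cap_of_pin` on `[0, T + 1/8]` with part 21's
afterglow numeric `headline_afterglow`, and `√(2 - 24 log K/K¹⁰) ≤ s₀ < T`.
[cite: Tao2016AveragedNS, §5.5 Theorem 5.3, (5.5), (5.6), (energy-con), (tcable)] -/
theorem knob_dud_holds {K ε ρ : ℝ} {X : ℝ → Fin 5 → ℝ} {C : ℝ → ℝ}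
    (hX : ∀ t, HasDerivAt X (RotorKnob.rotorCircuit K (K ^ 10) ε ρ (X t)) t)
    (h0 : X 0 = delayInit) (hC : ∀ t, HasDerivAt C (X t 2) t) (hK : 16 ≤ K) (hε : 0 < ε)
    (hεK : ε ^ 2 ≤ 1 / (6 * K ^ 20)) (hρ : 0 < ρ) (hlo : 200 * ε / K ^ 20 ≤ ρ ^ 2)
    (hhi : K ^ 10 * ρ ^ 2 ≤ 2 * ε) (k : ℕ) (hk : ε = k * K ^ 10 * ρ ^ 2) :
    ∀ t ∈ Icc 0 (√(2 - 24 * Real.log K / K ^ 10) + 1 / 8), X t 4 ^ 2 ≤ 1 / 100 := by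
  have hK0 : 0 < K := by linarith
  have hK10 : 0 < K ^ 10 := by positivity
  obtain ⟨s₀, T, hsq1, -, hs1, -, hsT, -, hbT, hcT, -, -, -, ha2, -⟩ :=
    knob_member_state_headline hX h0 hC hK hε hεK hρ hlo hhi
  -- on the lattice `w = k`: `sin kπ = 0`, `|cos kπ| = 1`
  have hw : ε / (K ^ 10 * ρ ^ 2) = k := by
    rw [div_eq_iff (by positivity), hk]; ring
  have hs : |sin (ε / (K ^ 10 * ρ ^ 2) * π)| = 0 := by
    rw [hw, Real.sin_nat_mul_pi, abs_zero]
  have hc : |cos (ε / (K ^ 10 * ρ ^ 2) * π)| = 1 := by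
    rw [hw]; exact_mod_cast Real.abs_cos_int_mul_pi k
  rw [hs, hc] at ha2
  have hpin : 19931 / 20000 ≤ |X T 0| := by linarith
  have hs0 : 0 ≤ s₀ := by linarith
  have hT0 : 0 ≤ T := by linarith
  have hlow : √(2 - 24 * Real.log K / K ^ 10) ≤ s₀ := (Real.sqrt_le_left hs0).2 hsq1
  -- `ρ² ≤ 2ε/K¹⁰ ≤ ε ≤ 1`
  have h10 : (1099511627776 : ℝ) ≤ K ^ 10 := by
    have := headline_pow_floor hK 10; norm_num at this; exact this
  have hρε : ρ ^ 2 ≤ ε := by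
    have := mul_le_mul_of_nonneg_right h10 (sq_nonneg ρ)
    linarith
  have hε1 : ε ≤ 1 := by
    have hK20 : (1700 : ℝ) ≤ K ^ 20 :=
      le_trans (by norm_num) (pow_le_pow_left₀ (by norm_num) hK 20)
    have h1 : ε ^ 2 ≤ 1 := by
      refine hεK.trans ?_
      rw [div_le_one (by positivity)]; linarith
    nlinarith
  -- the self-timed window `β/(2ε) = 1/8` and the afterglow at `β = ε/4`, `M = K¹⁰`
  have h8 : ε / 4 / (2 * ε) = 1 / 8 := by
    field_simp; ring
  have hA2 : 4 * ε * (1 / K ^ 10 + 4 * exp (-K ^ 10) / K ^ 10 + ε) / (K ^ 10 * (ε / 4))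
      = 16 * (1 / K ^ 10 + 4 * exp (-K ^ 10) / K ^ 10 + ε) / K ^ 10 := by
    field_simp; ring
  have hAd := headline_afterglow hK hεK (ε := ε)
  intro t ht
  have ht' : t ∈ Icc 0 (T + ε / 4 / (2 * ε)) := by
    rw [h8]; exact ⟨ht.1, by linarith [ht.2]⟩
  have hcap := knob_member_cap_of_pin hX h0 hε hε1 hρ hρε hK10 hK0.le
    (lam₀ := 1 / K ^ 10 + 4 * exp (-K ^ 10) / K ^ 10) hT0 (by positivity) hbT hcT
    (by norm_num) hpin ht'
  rw [hA2] at hcap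
  have hn : (1 : ℝ) - (19931 / 20000) ^ 2 + 1 / 1000 ≤ 1 / 100 := by norm_num
  linarith

end Summit.NavierStokesRegularity.FluidComputer.GateBudget
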